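import Summits.AnomalousDissipation.AnomalousDissipation.Theorems.SolenoidalFractalHomogenisationLagrangianStepSidebandXSlowDefsFrame
import Summits.AnomalousDissipation.AnomalousDissipation.Theorems.SolenoidalFractalHomogenisationLagrangianStepSidebandXEffGenDefs
import HarnessLib

/-!
# K1L_D `LagrangianRenormalisationStepDesign` (stmt-AnomalousDissipation-27980), registered stub `stub_D1_V0thg` (v28, D28-3 (3)/D28-6/D28-7), port-map layer L5:
# THE TWISTED AUGMENTED EFFECTIVE SLOW GENERATOR on `ℂ³` (shared definition; reviewed; `--kind definition --supports stmt-AnomalousDissipation-27980 --as helper`)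

Summits-side DEFINITIONS file of route `SolenoidalFractalHomogenisation` (prover seat `ad-k1l-cellLawV-w1` g9; road of record D28-7 = port map §3 L5).  Frozen-frame twin of
`…SidebandXEffGenDefs`: `effGenCθ 𝔹' G₀ ℓ r₁ = (4π² P^θ_ℓ T_{𝔹'ᵀ}(ℓ) P^θ_ℓ)↾ℝ + r₁ • (1 − P^θ_ℓ)↾ℝ`, `P^θ_ℓ = transversalProjR (twistFreq G₀ ℓ)` — the INTEGER mode `ℓ` in the
symbol (so both the cell's generator, `𝔹' = (1/n²)(conj G₀ 𝔸 + (1/ν) psiStarθ)`, whose link factors are flat, and the coarse member's, `𝔹' = conj G₀ 𝔹_c`, are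
instances; `symbT` is additive in the tensor), only the projection twisted; `effGenCθ_apply`, `effGenCθ_one : effGenCθ 𝔹' 1 ℓ r₁ = effGenC 𝔹' ℓ r₁`.
NOT a proof of anything; rung F-D1.A0 infrastructure.  AD is not proved.
-/

set_option linter.dupNamespace false

noncomputable section

namespace Summit.AnomalousDissipation.AnomalousDissipation.Theorems.SolenoidalFractalHomogenisation.LagrangianStep.Sideband

open Set MeasureTheory Complex UnitAddTorus
open scoped InnerProductSpace
open Literature.Analysis Literature.Analysis.FunctionSpaces Literature.Analysis.FunctionSpaces.Torus
open Literature.Analysis.FluidPDE Literature.Analysis.FluidPDE.Torus Literature.Analysis.FluidPDE.LatticeShear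

/-- **The twisted augmented effective slow generator** `effGenCθ 𝔹' G₀ ℓ r₁ = (4π² P^θ_ℓ T_{𝔹'ᵀ}(ℓ) P^θ_ℓ)↾ℝ + r₁ • (1 − P^θ_ℓ)↾ℝ` on `ℂ³`
(`P^θ_ℓ = transversalProjR (twistFreq G₀ ℓ)`). [cite: MajdaKramer1999, §2.2.1.3 (55) (effective diffusivity)] [cite: ArmstrongVicol2025, §4.1 (PDF p. 34)] -/
def effGenCθ (𝔹' : Torus.Visc4 (Fin 3)) (G₀ : Matrix (Fin 3) (Fin 3) ℝ) (ℓ : Fin 3 → ℤ) (r₁ : ℝ) : EuclideanSpace ℂ (Fin 3) →L[ℝ] EuclideanSpace ℂ (Fin 3) :=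
  ((((4 * Real.pi ^ 2 : ℝ) : ℂ) • ((transversalProjR (twistFreq G₀ ℓ)).comp (symbTL (Torus.majorTranspose 𝔹') ℓ))).comp
      (transversalProjR (twistFreq G₀ ℓ))).restrictScalars ℝ +
    r₁ • (ContinuousLinearMap.id ℂ (EuclideanSpace ℂ (Fin 3)) - transversalProjR (twistFreq G₀ ℓ)).restrictScalars ℝ

/-- Unfolding `effGenCθ` on a vector. [cite: MajdaKramer1999, §2.2.1.3 (55)] -/
theorem effGenCθ_apply (𝔹' : Torus.Visc4 (Fin 3)) (G₀ : Matrix (Fin 3) (Fin 3) ℝ) (ℓ : Fin 3 → ℤ) (r₁ : ℝ) (v : EuclideanSpace ℂ (Fin 3)) :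
    effGenCθ 𝔹' G₀ ℓ r₁ v =
      (((4 * Real.pi ^ 2 : ℝ) : ℂ)) • transversalProjR (twistFreq G₀ ℓ) (Torus.symbT (Torus.majorTranspose 𝔹') ℓ (transversalProjR (twistFreq G₀ ℓ) v)) +
        r₁ • (v - transversalProjR (twistFreq G₀ ℓ) v) := by
  simp only [effGenCθ, add_apply, ContinuousLinearMap.coe_restrictScalars', ContinuousLinearMap.comp_apply, smul_apply,
    sub_apply, ContinuousLinearMap.id_apply, symbTL_apply]

/-- **Consistency at the identity frame**: `effGenCθ 𝔹' 1 ℓ r₁ = effGenC 𝔹' ℓ r₁` (`modalAdjGen 𝔸 k = 4π² • P_k ∘ T_𝔸(k)`).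
[cite: MajdaKramer1999, §2.2.1.3 (55)] -/
theorem effGenCθ_one (𝔹' : Torus.Visc4 (Fin 3)) (ℓ : Fin 3 → ℤ) (r₁ : ℝ) : effGenCθ 𝔹' 1 ℓ r₁ = effGenC 𝔹' ℓ r₁ := by
  apply ContinuousLinearMap.ext
  intro v
  rw [effGenCθ_apply, effGenC_apply, twistFreq_one, transversalProjR_intCast, Torus.modalAdjGen_apply]

end Summit.AnomalousDissipation.AnomalousDissipation.Theorems.SolenoidalFractalHomogenisation.LagrangianStep.Sideband

end
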